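import Summits.Ventures.LatticeQCDFlow.Scoring.FreeFieldHeatBath
import Summits.Ventures.LatticeQCDFlow.Scoring.SchwingerDysonFreePropagator
import HarnessLib

/-!
# The heat bath is exact for the free field on `ℝ^Λ`: the Gibbs law is invariant, site by site and under the random scan

HONEST FRAMING: exact (Metropolis-corrected) sampling algorithms for lattice gauge theory;
figures of merit are autocorrelation/cost numbers at stated couplings and volumes; no
continuum-physics claim.  (SCALAR calibration rung S0-A: not a gauge result.)

Venture `LatticeQCDFlow` (cell pub-lqcd), topic `Exactness`; FANOUT row 2 (`s0-phi4`, the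
exactness battery's scalar legs).  NEW WORK of the cell (Fubini over `ℝ^{n+1}` and one Gaussian
integral, over Mathlib); nothing is cited as a fact.  Printed counterparts, named only: Geman–Geman
1984 / Gelfand–Smith 1990 (the Gibbs sampler leaves the joint law invariant), Goodman–Sokal 1989
(heat bath on the Gaussian model), Kazashi–Müller–Scheichl 2024 (arXiv:2407.12149 §3.2: the random
smoother "leave[s] the target distribution invariant").

`Exactness/HeatBath.lean` (row 9) proves heat-bath exactness on FINITE product spaces by finite
sums; `Exactness/Phi4SiteLaw.lean` treats the one-site φ⁴ law.  This file is the CONTINUUM-VALUED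
statement for the free lattice field on `ℝ^{n+1}` with Lebesgue reference measure, for the kernel
`siteUpdate J 1 x` of `Scoring/FreeFieldHeatBath.lean` (new `φ_x ∼ N(μ_x(φ), 1/(2J_{xx}))`, the
conditional law — `heatBath_condDensity` there).

## What is proved (`Λ = Fin (n+1)`, `S = Σ φJφ` = `latticePhi4Action J 0`, weight `e^{−S}` = `gibbsWeight J 0`)

* `siteUpdate_one_eq` / `siteUpdate_one_update` — at `ω = 1` the kernel reads
  `(P_x f)(φ) = ∫ f(φ|φ_x:=s) dN(μ_x(φ), 1/(2J_{xx}))(s)` and is CONSTANT along the coordinate line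
  of `x` (`J_{xx} ≠ 0`); `abs_siteUpdate_le` — `|P_x f| ≤ B` if `|f| ≤ B`;
  `measurable_siteUpdate` — `P_x f` is (strongly) measurable for measurable `f` (`J_{xx} > 0`:
  density form + `StronglyMeasurable.integral_prod_right'`).
* `integral_eq_integral_insertNth` — `∫_{ℝ^{n+1}} G = ∫_{x'} ∫_t G(insertNth x t x')` for
  integrable `G` (`MeasurableEquiv.piFinSuccAbove`, volume preserving); `siteZ_pos` — the one-site
  normaliser `∫ e^{−S(φ|φ_x:=s)} ds > 0`; **`condDensity_mul_siteZ`** — conditional density ×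
  conditional normaliser = joint density:
  `gaussianPDFReal μ_x(φ) (1/(2J_{xx})) s · ∫ e^{−S(φ|φ_x:=u)} du = e^{−S(φ|φ_x:=s)}`.
* **`heatBath_site_exact`** — if `S` is coercive (`εΣφ² − K ≤ S`; e.g. `J + Jᵀ ≽ 2ε`,
  `latticePhi4Action_coercive_of_quadForm_ge`) and `J_{xx} > 0`, then for every bounded measurable
  observable `f`: `∫ (P_x f) e^{−S} dφ = ∫ f e^{−S} dφ`; `heatBath_site_exact_expect`:
  `⟨P_x f⟩ = ⟨f⟩` (`gibbsExpect`).  Bounded measurable functions separate finite measures, so this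
  IS the invariance `πP_x = π` of the Gibbs law `π = e^{−S}dφ/Z` under the one-site heat bath —
  whatever the current `φ_x`, for every exterior (proof: split off the `x`-coordinate, the kernel
  value is constant on the line and equals `∫ pdf·f`, and `pdf · Z_x = e^{−S}` on the line).
* **`heatBath_scan_exact_expect`** — the random-scan operator `P = |Λ|⁻¹ Σ_x P_x`
  (`scanUpdate J 1`) satisfies `⟨P f⟩ = ⟨f⟩` (all `J_{xx} > 0`);
  **`heatBath_scan_exact_shift`** — the ENGINE INSTANCE: `J = shiftCoupling σ m² = −Δ_lat + m²`
  with shifts fixing no site and `m² > 0` (coercive by `shiftCoupling_coercive_of_pos_mass`,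
  `J_{xx} = 2d + m² > 0` by `shiftCoupling_diag`): the free `phi4_2d` law is invariant under the
  random-scan heat bath, unconditionally.

Consequence for `Scoring/FreeFieldHeatBathSpectrum.lean`: the chain started in the Gibbs law is
stationary, so its closed-form `⟨(P^t O_b) O_b⟩` IS the stationary autocovariance and the `τ_int`
/ `z = 2` statements there are statements about the equilibrium chain.  NOT CLAIMED: `ω ≠ 1`
(Adler's over-relaxed kernel is also exact — the AR(1) kernel `t ↦ (1−ω)t + ωμ + √(ω(2−ω))σξ`
preserves `N(μ, σ²)` — not proved here); `λ > 0` (the conditional law is then the quartic site law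
of `Exactness/Phi4SiteLaw.lean`, not Gaussian); the ordered sweep (a composition of exact kernels,
`Exactness/SequentialScanAdjoint.lean` pattern); convergence / uniqueness of the invariant law.
-/

namespace Summit.Ventures.LatticeQCDFlow.Exactness

open Real MeasureTheory ProbabilityTheory Finset Filter
open Summit.Ventures.LatticeQCDFlow.Scoring

variable {n : ℕ}

/-- The heat bath (`ω = 1`) written with the conditional mean and variance of
`Scoring/FreeFieldHeatBath.lean`: `(P_x f)(φ) = ∫ f(φ|φ_x:=s) dN(μ_x(φ), 1/(2J_{xx}))(s)`. -/
theorem siteUpdate_one_eq (J : Fin (n + 1) → Fin (n + 1) → ℝ) (x : Fin (n + 1))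
    (f : (Fin (n + 1) → ℝ) → ℝ) (φ : Fin (n + 1) → ℝ) :
    siteUpdate J 1 x f φ
      = ∫ s, f (Function.update φ x s)
          ∂gaussianReal (hbMean J φ x) (Real.toNNReal (1 / (2 * J x x))) := by
  have h1 : φ x - 1 * (latticePhi4Force J 0 φ x / (2 * J x x)) = hbMean J φ x := by
    unfold hbMean; ring
  have h2 : (1 : ℝ) * (2 - 1) / (2 * J x x) = 1 / (2 * J x x) := by ring
  rw [siteUpdate, h1, h2]

/-- Along the coordinate line the heat bath is constant: `(P_x f)(φ|φ_x:=t) = (P_x f)(φ)`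
(the new value is drawn from the conditional law, which ignores the old `φ_x`). -/
theorem siteUpdate_one_update (J : Fin (n + 1) → Fin (n + 1) → ℝ) (x : Fin (n + 1))
    (hJ : J x x ≠ 0) (f : (Fin (n + 1) → ℝ) → ℝ) (φ : Fin (n + 1) → ℝ) (t : ℝ) :
    siteUpdate J 1 x f (Function.update φ x t) = siteUpdate J 1 x f φ := by
  rw [siteUpdate_one_eq, siteUpdate_one_eq, hbMean_update J φ x hJ t]
  simp only [Function.update_idem]

/-- The heat bath of a bounded observable is bounded by the same constant. -/
theorem abs_siteUpdate_le (J : Fin (n + 1) → Fin (n + 1) → ℝ) (x : Fin (n + 1))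
    {f : (Fin (n + 1) → ℝ) → ℝ} {B : ℝ} (hfb : ∀ φ, |f φ| ≤ B) (φ : Fin (n + 1) → ℝ) :
    |siteUpdate J 1 x f φ| ≤ B := by
  rw [siteUpdate_one_eq]
  have h := norm_integral_le_of_norm_le_const
    (μ := gaussianReal (hbMean J φ x) (Real.toNNReal (1 / (2 * J x x))))
    (f := fun s => f (Function.update φ x s)) (C := B)
    (Eventually.of_forall fun s => by rw [Real.norm_eq_abs]; exact hfb _)
  rw [probReal_univ, mul_one, Real.norm_eq_abs] at h
  exact h

/-- The heat bath of a measurable observable is a measurable observable (`J_{xx} > 0`): written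
against Lebesgue measure with the Gaussian density, it is a parametric integral of a jointly
measurable integrand. -/
theorem measurable_siteUpdate (J : Fin (n + 1) → Fin (n + 1) → ℝ) (x : Fin (n + 1))
    (hJ : 0 < J x x) {f : (Fin (n + 1) → ℝ) → ℝ} (hfm : Measurable f) :
    StronglyMeasurable (siteUpdate J 1 x f) := by
  set v : NNReal := Real.toNNReal (1 / (2 * J x x)) with hv
  have hv0 : v ≠ 0 := by
    rw [hv]
    have : 0 < 1 / (2 * J x x) := by positivity
    exact (Real.toNNReal_pos.mpr this).ne'
  -- the density form
  have hdens : siteUpdate J 1 x f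
      = fun φ => ∫ s, gaussianPDFReal (hbMean J φ x) v s * f (Function.update φ x s) := by
    funext φ
    rw [siteUpdate_one_eq, integral_gaussianReal_eq_integral_smul hv0]
    rfl
  rw [hdens]
  -- joint measurability of the integrand
  have hmean : Continuous fun φ : Fin (n + 1) → ℝ => hbMean J φ x := by
    unfold hbMean
    exact ((continuous_apply x).sub
      ((continuous_latticePhi4Force J 0 x).div_const _))
  have hpdf : Continuous fun p : (Fin (n + 1) → ℝ) × ℝ => gaussianPDFReal (hbMean J p.1 x) v p.2 := by
    simp only [gaussianPDFReal_def]
    have h1 : Continuous fun p : (Fin (n + 1) → ℝ) × ℝ => hbMean J p.1 x :=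
      hmean.comp continuous_fst
    fun_prop
  have hF : Measurable fun p : (Fin (n + 1) → ℝ) × ℝ =>
      gaussianPDFReal (hbMean J p.1 x) v p.2 * f (Function.update p.1 x p.2) :=
    hpdf.measurable.mul (hfm.comp measurable_update')
  exact hF.stronglyMeasurable.integral_prod_right'

/-- Splitting an integral over `ℝ^{n+1}` along the `x`-th coordinate. -/
theorem integral_eq_integral_insertNth (x : Fin (n + 1)) {G : (Fin (n + 1) → ℝ) → ℝ}
    (hG : Integrable G) :
    ∫ φ, G φ = ∫ x' : Fin n → ℝ, ∫ t : ℝ, G (Fin.insertNth x t x') := by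
  set e := MeasurableEquiv.piFinSuccAbove (fun _ : Fin (n + 1) => ℝ) x with he
  have hmp : MeasurePreserving e := volume_preserving_piFinSuccAbove (fun _ : Fin (n + 1) => ℝ) x
  rw [← (hmp.symm e).integral_comp e.symm.measurableEmbedding]
  have hG' : Integrable (fun z : ℝ × (Fin n → ℝ) => G (e.symm z))
      ((volume : Measure ℝ).prod (volume : Measure (Fin n → ℝ))) :=
    (hmp.symm e).integrable_comp_emb e.symm.measurableEmbedding |>.2 hG
  rw [show (volume : Measure (ℝ × (Fin n → ℝ))) = (volume : Measure ℝ).prod volume from rfl,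
    integral_prod_symm _ hG']
  rfl

/-- The one-site normaliser is positive: `∫ e^{−S(φ|φ_x:=s)} ds > 0` (`J_{xx} > 0`). -/
theorem siteZ_pos (J : Fin (n + 1) → Fin (n + 1) → ℝ) (x : Fin (n + 1)) (hJ : 0 < J x x)
    (φ : Fin (n + 1) → ℝ) :
    0 < ∫ s, gibbsWeight J 0 (Function.update φ x s) := by
  set m := hbMean J φ x with hm
  set C := latticePhi4Action J 0 (Function.update φ x m) with hC
  have hsq : (fun s => gibbsWeight J 0 (Function.update φ x s))
      = fun s => Real.exp (-C) * Real.exp (-(J x x) * (s - m) ^ 2) := by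
    funext s
    rw [gibbsWeight, latticePhi4Action_update_sq J φ x hJ.ne' s, ← Real.exp_add]
    congr 1
    ring
  rw [hsq, integral_const_mul]
  refine mul_pos (Real.exp_pos _) ?_
  have h := integral_sub_right_eq_self (μ := (volume : Measure ℝ))
    (fun s => Real.exp (-(J x x) * s ^ 2)) m
  rw [h, integral_gaussian]
  exact Real.sqrt_pos.mpr (div_pos Real.pi_pos hJ)

/-- **The conditional density times the conditional normaliser is the joint density**:
`gaussianPDFReal μ_x(φ) (1/(2J_{xx})) s · ∫ e^{−S(φ|φ_x:=u)} du = e^{−S(φ|φ_x:=s)}`. -/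
theorem condDensity_mul_siteZ (J : Fin (n + 1) → Fin (n + 1) → ℝ) (x : Fin (n + 1))
    (hJ : 0 < J x x) (φ : Fin (n + 1) → ℝ) (s : ℝ) :
    gaussianPDFReal (hbMean J φ x) (Real.toNNReal (1 / (2 * J x x))) s
        * ∫ u, gibbsWeight J 0 (Function.update φ x u)
      = gibbsWeight J 0 (Function.update φ x s) := by
  have h := heatBath_condDensity J φ x hJ s
  have hZ := siteZ_pos J x hJ φ
  unfold gibbsWeight at hZ ⊢
  rw [← h, div_mul_cancel₀ _ hZ.ne']

/-- **THE HEAT BATH IS EXACT FOR THE FREE FIELD (one site).**  Let `S = Σ φJφ` be coercive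
(`εΣφ² − K ≤ S`, e.g. `J + Jᵀ ≽ 2ε`; the engine's `m² > 0`) with `J_{xx} > 0`.  For every bounded
measurable observable `f`, resampling `φ_x` from its conditional law leaves the Gibbs integral
unchanged: `∫ (P_x f) e^{−S} dφ = ∫ f e^{−S} dφ`.  Since bounded measurable `f` separate measures,
this says the law `e^{−S}dφ/Z` is INVARIANT under the heat-bath kernel at `x`. -/
theorem heatBath_site_exact {J : Fin (n + 1) → Fin (n + 1) → ℝ} {ε K : ℝ} (hε : 0 < ε)
    (hS : ∀ φ : Fin (n + 1) → ℝ, ε * ∑ w, φ w ^ 2 - K ≤ latticePhi4Action J 0 φ)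
    (x : Fin (n + 1)) (hJ : 0 < J x x) {f : (Fin (n + 1) → ℝ) → ℝ} (hfm : Measurable f)
    {B : ℝ} (hfb : ∀ φ, |f φ| ≤ B) :
    ∫ φ, siteUpdate J 1 x f φ * gibbsWeight J 0 φ = ∫ φ, f φ * gibbsWeight J 0 φ := by
  have hw : Integrable (gibbsWeight J 0) := integrable_gibbsWeight_of_coercive hε hS
  -- both integrands are integrable: bounded × integrable
  have hG1 : Integrable (fun φ => f φ * gibbsWeight J 0 φ) := by
    refine Integrable.mono' (hw.const_mul B) (hfm.aestronglyMeasurable.mul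
      (continuous_gibbsWeight J 0).aestronglyMeasurable) (Eventually.of_forall fun φ => ?_)
    rw [Real.norm_eq_abs, abs_mul, abs_of_pos (gibbsWeight_pos J 0 φ)]
    exact mul_le_mul_of_nonneg_right (hfb φ) (gibbsWeight_pos J 0 φ).le
  have hG2 : Integrable (fun φ => siteUpdate J 1 x f φ * gibbsWeight J 0 φ) := by
    refine Integrable.mono' (hw.const_mul B)
      ((measurable_siteUpdate J x hJ hfm).aestronglyMeasurable.mul
        (continuous_gibbsWeight J 0).aestronglyMeasurable) (Eventually.of_forall fun φ => ?_)
    rw [Real.norm_eq_abs, abs_mul, abs_of_pos (gibbsWeight_pos J 0 φ)]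
    exact mul_le_mul_of_nonneg_right (abs_siteUpdate_le J x hfb φ) (gibbsWeight_pos J 0 φ).le
  rw [integral_eq_integral_insertNth x hG2, integral_eq_integral_insertNth x hG1]
  refine integral_congr_ae (Eventually.of_forall fun x' => ?_)
  -- the exterior `x'` is frozen; `ψ` is the configuration with `φ_x = 0`
  set ψ : Fin (n + 1) → ℝ := Fin.insertNth x (0 : ℝ) x' with hψ
  have hins : ∀ t : ℝ, (Fin.insertNth x t x' : Fin (n + 1) → ℝ) = Function.update ψ x t :=
    fun t => insertNth_eq_update x t x'
  simp only [hins]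
  -- left: the heat bath is constant along the line, so it factors out of the `t`-integral
  have hconst : ∀ t, siteUpdate J 1 x f (Function.update ψ x t) = siteUpdate J 1 x f ψ :=
    fun t => siteUpdate_one_update J x hJ.ne' f ψ t
  simp only [hconst]
  rw [integral_const_mul]
  -- and equals `∫ pdf(s) f(ψ|s) ds`; multiply the normaliser in
  have hv0 : (Real.toNNReal (1 / (2 * J x x))) ≠ 0 := by
    have : 0 < 1 / (2 * J x x) := by positivity
    exact (Real.toNNReal_pos.mpr this).ne'
  rw [siteUpdate_one_eq, integral_gaussianReal_eq_integral_smul hv0, ← integral_mul_const]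
  refine integral_congr_ae (Eventually.of_forall fun s => ?_)
  simp only [smul_eq_mul]
  rw [mul_right_comm, condDensity_mul_siteZ J x hJ ψ s, mul_comm]

/-- **Normalised form**: `⟨P_x f⟩ = ⟨f⟩` in the Gibbs law `e^{−S}/Z`. -/
theorem heatBath_site_exact_expect {J : Fin (n + 1) → Fin (n + 1) → ℝ} {ε K : ℝ} (hε : 0 < ε)
    (hS : ∀ φ : Fin (n + 1) → ℝ, ε * ∑ w, φ w ^ 2 - K ≤ latticePhi4Action J 0 φ)
    (x : Fin (n + 1)) (hJ : 0 < J x x) {f : (Fin (n + 1) → ℝ) → ℝ} (hfm : Measurable f)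
    {B : ℝ} (hfb : ∀ φ, |f φ| ≤ B) :
    gibbsExpect J 0 (siteUpdate J 1 x f) = gibbsExpect J 0 f := by
  unfold gibbsExpect
  rw [heatBath_site_exact hε hS x hJ hfm hfb]

/-- **THE RANDOM-SCAN HEAT BATH IS EXACT**: `⟨P f⟩ = ⟨f⟩` for the scan operator
`P = |Λ|⁻¹ Σ_x P_x` (every diagonal entry `J_{xx} > 0`). -/
theorem heatBath_scan_exact_expect {J : Fin (n + 1) → Fin (n + 1) → ℝ} {ε K : ℝ} (hε : 0 < ε)
    (hS : ∀ φ : Fin (n + 1) → ℝ, ε * ∑ w, φ w ^ 2 - K ≤ latticePhi4Action J 0 φ)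
    (hJ : ∀ x, 0 < J x x) {f : (Fin (n + 1) → ℝ) → ℝ} (hfm : Measurable f)
    {B : ℝ} (hfb : ∀ φ, |f φ| ≤ B) :
    gibbsExpect J 0 (scanUpdate J 1 f) = gibbsExpect J 0 f := by
  have hw : Integrable (gibbsWeight J 0) := integrable_gibbsWeight_of_coercive hε hS
  have hI : ∀ x, Integrable (fun φ => siteUpdate J 1 x f φ * gibbsWeight J 0 φ) := by
    intro x
    refine Integrable.mono' (hw.const_mul B)
      ((measurable_siteUpdate J x (hJ x) hfm).aestronglyMeasurable.mul
        (continuous_gibbsWeight J 0).aestronglyMeasurable) (Eventually.of_forall fun φ => ?_)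
    rw [Real.norm_eq_abs, abs_mul, abs_of_pos (gibbsWeight_pos J 0 φ)]
    exact mul_le_mul_of_nonneg_right (abs_siteUpdate_le J x hfb φ) (gibbsWeight_pos J 0 φ).le
  unfold scanUpdate
  rw [gibbsExpect_const_mul, gibbsExpect_sum J 0 Finset.univ (fun x _ => hI x)]
  simp only [heatBath_site_exact_expect hε hS _ (hJ _) hfm hfb, Finset.sum_const,
    Finset.card_univ, nsmul_eq_mul, Fintype.card_fin]
  have h : ((n + 1 : ℕ) : ℝ) ≠ 0 := by positivity
  rw [← mul_assoc, inv_mul_cancel₀ h, one_mul]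

/-- **The engine instance**: for the free `phi4_2d` action (`J = −Δ_lat + m²`, shifts fixing no
site, `m² > 0`) the random-scan heat bath leaves `e^{−S}/Z` invariant:
`⟨P f⟩ = ⟨f⟩` for every bounded measurable `f`. -/
theorem heatBath_scan_exact_shift {ι : Type*} [Fintype ι] (σ : ι → Equiv.Perm (Fin (n + 1)))
    {m2 : ℝ} (hm2 : 0 < m2) (hσ : ∀ μ x, σ μ x ≠ x) {f : (Fin (n + 1) → ℝ) → ℝ}
    (hfm : Measurable f) {B : ℝ} (hfb : ∀ φ, |f φ| ≤ B) :
    gibbsExpect (shiftCoupling σ m2) 0 (scanUpdate (shiftCoupling σ m2) 1 f)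
      = gibbsExpect (shiftCoupling σ m2) 0 f := by
  have hS := shiftCoupling_coercive_of_pos_mass σ (m2 := m2) le_rfl
  have hJ : ∀ x, 0 < shiftCoupling σ m2 x x := by
    intro x
    rw [shiftCoupling_diag σ m2 x (fun μ => hσ μ x)]
    positivity
  exact heatBath_scan_exact_expect hm2 hS hJ hfm hfb

end Summit.Ventures.LatticeQCDFlow.Exactness
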